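import Literature.RingTheory.Etale.WeaklyEtaleLocalIso
import Literature.RingTheory.Etale.EtaleCoproduct

/-!
# The germ ring of a weakly étale algebra over a cover with split étale covers

[cite: BhattScholze2015 = arXiv:1309.1198v2, Theorem 2.3.4; StacksProject, Tag 097Z]

This file performs the globalization step of Bhatt–Scholze, Theorem 2.3.4, in the following
form.  Let `A → B` be weakly étale, `A → C` ind-étale (`FactorsEtale A C`) such that every
faithfully flat étale `C`-algebra has a retraction, and `J ⊂ C` an ideal all primes above which
are maximal.  Put `D₀ = C ⊗[A] B` and let `X♮` be the set of primes `x ⊂ D₀` above `J`.  By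
`bijective_localRingHom_of_retraction`, `C_{x ∩ C} → (D₀)_x` is bijective for `x ∈ X♮`, whence
ring maps `ρ_x : B → C_{x ∩ C}`.  The **germ ring** `C♮ ⊂ ∏_{x ∈ X♮} C_{x ∩ C}` of families which
are, piecewise for a finite partition of `X♮` into sets `D(t) ∩ V(F)`, given by fractions
`c / s` with `c, s ∈ C`, is an `A`-algebra receiving `B` (via `ρ`) with

* `FactorsEtale A C♮` (finitely presented `A`-algebras mapping to `C♮` factor through finite
  products of localizations `C[1/s]`, refining partitions by quasi-compactness), hence
* `B → C♮` is flat (Stacks 092C), and it is faithfully flat as soon as every maximal ideal of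
  `B` lies under a point of `X♮`.
-/

universe u

namespace Literature.RingTheory.Etale

open TensorProduct IsLocalRing

noncomputable section

namespace GermRing

variable {A B C : Type u} [CommRing A] [CommRing B] [CommRing C] [Algebra A B] [Algebra A C]

/-! ### Points and local rings -/

variable (A B) in
/-- The points of `X♮`: primes of `C ⊗[A] B` containing `J`. [cite: BhattScholze2015, Thm 2.3.4] -/
def Pt (J : Ideal C) : Type u :=
  {x : PrimeSpectrum (C ⊗[A] B) // J.map (algebraMap C (C ⊗[A] B)) ≤ x.asIdeal}

variable {J : Ideal C}

/-- The prime `x ∩ C` of `C` under a point (an `abbrev`, so that `IsPrime` instances are found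
through Mathlib's `PrimeSpectrum.isPrime` and `Ideal.IsPrime.under`). [folklore] -/
abbrev Pt.under (x : Pt A B J) : Ideal C := x.1.asIdeal.under C

/-- `J ⊆ x ∩ C`. [folklore] -/
theorem Pt.le_under (x : Pt A B J) : J ≤ Pt.under x :=
  Ideal.map_le_iff_le_comap.1 x.2

/-- The local ring `C_{x ∩ C}`. [folklore] -/
abbrev Rx (x : Pt A B J) : Type u := Localization.AtPrime (Pt.under x)

/-- The local ring `(C ⊗ B)_x`. [folklore] -/
abbrev Sx (x : Pt A B J) : Type u := Localization.AtPrime x.1.asIdeal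

/-- The canonical local map `C_{x ∩ C} → (C ⊗ B)_x`. [folklore] -/
def locx (x : Pt A B J) : Rx x →+* Sx x :=
  Localization.localRingHom (Pt.under x) x.1.asIdeal (algebraMap C (C ⊗[A] B)) rfl

/-- `locx` on elements of `C`. [folklore] -/
theorem locx_algebraMap (x : Pt A B J) (c : C) :
    locx x (algebraMap C (Rx x) c) = algebraMap (C ⊗[A] B) (Sx x) (algebraMap C (C ⊗[A] B) c) :=
  Localization.localRingHom_to_map _ _ _ rfl c


/-! ### Pieces and germ representations -/

/-- The basic piece `X♮ ∩ D(t) ∩ V(F)`. [folklore] -/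
def piece (t : C ⊗[A] B) (F : Finset (C ⊗[A] B)) : Set (Pt A B J) :=
  {x | t ∉ x.1.asIdeal ∧ ∀ g ∈ F, g ∈ x.1.asIdeal}

/-- Membership in a basic piece. [folklore] -/
theorem mem_piece {t : C ⊗[A] B} {F : Finset (C ⊗[A] B)} {x : Pt A B J} :
    x ∈ piece t F ↔ t ∉ x.1.asIdeal ∧ ∀ g ∈ F, g ∈ x.1.asIdeal := Iff.rfl

/-- Intersections of basic pieces are basic pieces. [folklore] -/
theorem mem_piece_mul_union [DecidableEq (C ⊗[A] B)] {t t' : C ⊗[A] B}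
    {F F' : Finset (C ⊗[A] B)} {x : Pt A B J} :
    x ∈ piece (t * t') (F ∪ F') ↔ x ∈ piece t F ∧ x ∈ piece t' F' := by
  simp only [mem_piece, Finset.mem_union]
  constructor
  · rintro ⟨htt, hF⟩
    exact ⟨⟨fun h => htt (x.1.asIdeal.mul_mem_right _ h), fun g hg => hF g (Or.inl hg)⟩,
      ⟨fun h => htt (x.1.asIdeal.mul_mem_left _ h), fun g hg => hF g (Or.inr hg)⟩⟩
  · rintro ⟨⟨ht, hF⟩, ⟨ht', hF'⟩⟩
    refine ⟨fun h => ?_, fun g hg => hg.elim (hF g) (hF' g)⟩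
    rcases (inferInstance : x.1.asIdeal.IsPrime).mem_or_mem h with h | h
    exacts [ht h, ht' h]

/-- A **germ representation** of a family `f ∈ ∏_x C_{x ∩ C}`: a finite partition of `X♮` into
basic pieces on each of which `f = c / s` with `c, s ∈ C`. [cite: BhattScholze2015, Thm 2.3.4] -/
structure Rep (J : Ideal C) (f : ∀ x : Pt A B J, Rx x) where
  /-- index set of the partition -/
  ι : Type
  /-- finiteness of the partition -/
  fin : Fintype ι
  /-- the elements `t` of the pieces `D(t) ∩ V(F)` -/
  t : ι → C ⊗[A] B
  /-- the finite sets `F` of the pieces `D(t) ∩ V(F)` -/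
  F : ι → Finset (C ⊗[A] B)
  /-- numerators -/
  c : ι → C
  /-- denominators -/
  s : ι → C
  cover : ∀ x : Pt A B J, ∃ i, x ∈ piece (J := J) (t i) (F i)
  disj : ∀ (x : Pt A B J) (i j : ι), x ∈ piece (J := J) (t i) (F i) →
    x ∈ piece (J := J) (t j) (F j) → i = j
  denom : ∀ (x : Pt A B J) (i : ι), x ∈ piece (J := J) (t i) (F i) → s i ∉ Pt.under x
  eq : ∀ (x : Pt A B J) (i : ι), x ∈ piece (J := J) (t i) (F i) →
    f x * algebraMap C (Rx x) (s i) = algebraMap C (Rx x) (c i)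

/-- Families admitting a germ representation. [cite: BhattScholze2015, Thm 2.3.4] -/
def IsGerm (f : ∀ x : Pt A B J, Rx x) : Prop := Nonempty (Rep J f)

/-- Constants are germs. [folklore] -/
theorem isGerm_algebraMap (c₀ : C) : IsGerm (fun x : Pt A B J => algebraMap C (Rx x) c₀) :=
  ⟨{ ι := PUnit
     fin := inferInstance
     t := fun _ => 1
     F := fun _ => ∅
     c := fun _ => c₀
     s := fun _ => 1
     cover := fun x => ⟨PUnit.unit, fun h => (inferInstance : x.1.asIdeal.IsPrime).ne_top
       ((Ideal.eq_top_iff_one _).2 h), fun g hg => absurd hg (Finset.notMem_empty g)⟩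
     disj := fun _ _ _ _ _ => rfl
     denom := fun x _ _ h => (inferInstance : (Pt.under x).IsPrime).ne_top
       ((Ideal.eq_top_iff_one _).2 h)
     eq := fun x _ _ => by rw [map_one, mul_one] }⟩

/-- Sums of germs are germs (common refinement of the partitions). [folklore] -/
theorem IsGerm.add {f g : ∀ x : Pt A B J, Rx x} (hf : IsGerm f) (hg : IsGerm g) :
    IsGerm (f + g) := by
  classical
  obtain ⟨R₁⟩ := hf
  obtain ⟨R₂⟩ := hg
  letI := R₁.fin; letI := R₂.fin
  refine ⟨{ ι := R₁.ι × R₂.ι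
            fin := inferInstance
            t := fun p => R₁.t p.1 * R₂.t p.2
            F := fun p => R₁.F p.1 ∪ R₂.F p.2
            c := fun p => R₁.c p.1 * R₂.s p.2 + R₂.c p.2 * R₁.s p.1
            s := fun p => R₁.s p.1 * R₂.s p.2
            cover := fun x => ?_
            disj := fun x p q hp hq => ?_
            denom := fun x p hp h => ?_
            eq := fun x p hp => ?_ }⟩
  · obtain ⟨i, hi⟩ := R₁.cover x
    obtain ⟨j, hj⟩ := R₂.cover x
    exact ⟨(i, j), mem_piece_mul_union.2 ⟨hi, hj⟩⟩
  · obtain ⟨hp1, hp2⟩ := mem_piece_mul_union.1 hp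
    obtain ⟨hq1, hq2⟩ := mem_piece_mul_union.1 hq
    exact Prod.ext (R₁.disj x _ _ hp1 hq1) (R₂.disj x _ _ hp2 hq2)
  · obtain ⟨hp1, hp2⟩ := mem_piece_mul_union.1 hp
    rcases (inferInstance : (Pt.under x).IsPrime).mem_or_mem h with h | h
    exacts [R₁.denom x _ hp1 h, R₂.denom x _ hp2 h]
  · obtain ⟨hp1, hp2⟩ := mem_piece_mul_union.1 hp
    have e1 := R₁.eq x _ hp1
    have e2 := R₂.eq x _ hp2
    simp only [Pi.add_apply, map_mul, map_add]
    linear_combination (algebraMap C (Rx x) (R₂.s p.2)) * e1 +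
      (algebraMap C (Rx x) (R₁.s p.1)) * e2

/-- Products of germs are germs. [folklore] -/
theorem IsGerm.mul {f g : ∀ x : Pt A B J, Rx x} (hf : IsGerm f) (hg : IsGerm g) :
    IsGerm (f * g) := by
  classical
  obtain ⟨R₁⟩ := hf
  obtain ⟨R₂⟩ := hg
  letI := R₁.fin; letI := R₂.fin
  refine ⟨{ ι := R₁.ι × R₂.ι
            fin := inferInstance
            t := fun p => R₁.t p.1 * R₂.t p.2
            F := fun p => R₁.F p.1 ∪ R₂.F p.2
            c := fun p => R₁.c p.1 * R₂.c p.2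
            s := fun p => R₁.s p.1 * R₂.s p.2
            cover := fun x => ?_
            disj := fun x p q hp hq => ?_
            denom := fun x p hp h => ?_
            eq := fun x p hp => ?_ }⟩
  · obtain ⟨i, hi⟩ := R₁.cover x
    obtain ⟨j, hj⟩ := R₂.cover x
    exact ⟨(i, j), mem_piece_mul_union.2 ⟨hi, hj⟩⟩
  · obtain ⟨hp1, hp2⟩ := mem_piece_mul_union.1 hp
    obtain ⟨hq1, hq2⟩ := mem_piece_mul_union.1 hq
    exact Prod.ext (R₁.disj x _ _ hp1 hq1) (R₂.disj x _ _ hp2 hq2)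
  · obtain ⟨hp1, hp2⟩ := mem_piece_mul_union.1 hp
    rcases (inferInstance : (Pt.under x).IsPrime).mem_or_mem h with h | h
    exacts [R₁.denom x _ hp1 h, R₂.denom x _ hp2 h]
  · obtain ⟨hp1, hp2⟩ := mem_piece_mul_union.1 hp
    have e1 := R₁.eq x _ hp1
    have e2 := R₂.eq x _ hp2
    simp only [Pi.mul_apply, map_mul]
    linear_combination (g x * algebraMap C (Rx x) (R₂.s p.2)) * e1 +
      (algebraMap C (Rx x) (R₁.c p.1)) * e2


/-! ### Auxiliary maps out of the localizations `C[1/s]` -/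

section Away

/-- The canonical `A`-algebra map `C[1/s] → C_{x ∩ C}` for `s ∉ x ∩ C`. [folklore] -/
def awayToRx (s : C) (x : Pt A B J) (hs : s ∉ Pt.under x) :
    Localization.Away s →ₐ[A] Rx x :=
  { IsLocalization.Away.lift s (g := algebraMap C (Rx x))
      (IsLocalization.map_units (Rx x) (⟨s, hs⟩ : (Pt.under x).primeCompl)) with
    commutes' := fun a => by
      change IsLocalization.Away.lift s _ (algebraMap A (Localization.Away s) a) = _
      rw [IsScalarTower.algebraMap_apply A C (Localization.Away s), IsLocalization.Away.lift_eq,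
        ← IsScalarTower.algebraMap_apply] }

/-- `awayToRx` on elements of `C`. [folklore] -/
theorem awayToRx_algebraMap (s : C) (x : Pt A B J) (hs : s ∉ Pt.under x) (c : C) :
    awayToRx s x hs (algebraMap C (Localization.Away s) c) = algebraMap C (Rx x) c :=
  IsLocalization.Away.lift_eq s
    (IsLocalization.map_units (Rx x) (⟨s, hs⟩ : (Pt.under x).primeCompl)) c

/-- If `h ↦ 0` in `C_{x ∩ C}` then some `u ∉ x ∩ C` kills a numerator of `h`. [folklore] -/
theorem exists_mul_numerator_eq_zero (s : C) (x : Pt A B J) (hs : s ∉ Pt.under x)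
    (h : Localization.Away s) (m : ℕ) (a : C)
    (hma : h * algebraMap C (Localization.Away s) s ^ m = algebraMap C (Localization.Away s) a)
    (h0 : awayToRx s x hs h = 0) : ∃ u : C, u ∉ Pt.under x ∧ u * a = 0 := by
  have h1 : algebraMap C (Rx x) a = 0 := by
    rw [← awayToRx_algebraMap s x hs a, ← hma, map_mul, h0, zero_mul]
  obtain ⟨u, hu⟩ := (IsLocalization.map_eq_zero_iff (Pt.under x).primeCompl (Rx x) a).1 h1
  exact ⟨u, u.2, hu⟩

/-- The canonical `A`-algebra map `C[1/s] → C[1/(s u)]`. [folklore] -/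
def awayMul (s u : C) : Localization.Away s →ₐ[A] Localization.Away (s * u) :=
  { IsLocalization.Away.lift s (g := algebraMap C (Localization.Away (s * u)))
      (isUnit_of_mul_isUnit_left (by
        rw [← map_mul]; exact IsLocalization.Away.algebraMap_isUnit (s * u))) with
    commutes' := fun a => by
      change IsLocalization.Away.lift s _ (algebraMap A (Localization.Away s) a) = _
      rw [IsScalarTower.algebraMap_apply A C (Localization.Away s), IsLocalization.Away.lift_eq,
        ← IsScalarTower.algebraMap_apply] }

/-- `s` is a unit in `C[1/(s u)]`. [folklore] -/
theorem isUnit_algebraMap_away_mul (s u : C) :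
    IsUnit (algebraMap C (Localization.Away (s * u)) s) :=
  isUnit_of_mul_isUnit_left (by
    rw [← map_mul]; exact IsLocalization.Away.algebraMap_isUnit (s * u))

/-- `awayMul` on elements of `C`. [folklore] -/
theorem awayMul_algebraMap (s u c : C) :
    awayMul (A := A) s u (algebraMap C (Localization.Away s) c) =
      algebraMap C (Localization.Away (s * u)) c :=
  IsLocalization.Away.lift_eq s (isUnit_algebraMap_away_mul s u) c

/-- Killing a numerator kills the fraction after inverting the killer. [folklore] -/
theorem awayMul_eq_zero (s u : C) (h : Localization.Away s) (m : ℕ) (a : C)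
    (hma : h * algebraMap C (Localization.Away s) s ^ m = algebraMap C (Localization.Away s) a)
    (hu : u * a = 0) : awayMul (A := A) s u h = 0 := by
  have h1 : awayMul (A := A) s u h * algebraMap C (Localization.Away (s * u)) s ^ m = 0 := by
    have := congrArg (awayMul (A := A) s u) hma
    rw [map_mul, map_pow, awayMul_algebraMap, awayMul_algebraMap] at this
    rw [this, IsLocalization.map_eq_zero_iff (Submonoid.powers (s * u))]
    exact ⟨⟨s * u, Submonoid.mem_powers _⟩, by
      change s * u * a = 0
      rw [mul_assoc, hu, mul_zero]⟩
  have hunit : IsUnit (algebraMap C (Localization.Away (s * u)) s ^ m) :=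
    (isUnit_of_mul_isUnit_left (by
      rw [← map_mul]; exact IsLocalization.Away.algebraMap_isUnit (s * u))).pow m
  exact (hunit.mul_left_eq_zero).1 h1

/-- Compatibility of `awayMul` with the maps to `C_{x ∩ C}`. [folklore] -/
theorem awayToRx_awayMul (s u : C) (x : Pt A B J) (hs : s ∉ Pt.under x)
    (hsu : s * u ∉ Pt.under x) (h : Localization.Away s) :
    awayToRx (s * u) x hsu (awayMul (A := A) s u h) = awayToRx s x hs h := by
  obtain ⟨m, a, hma⟩ := IsLocalization.Away.surj s h
  have hunit : IsUnit (algebraMap C (Rx x) s ^ m) :=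
    (IsLocalization.map_units (Rx x) (⟨s, hs⟩ : (Pt.under x).primeCompl)).pow m
  refine (hunit.mul_left_inj).1 ?_
  have e1 := congrArg (awayToRx s x hs) hma
  rw [map_mul, map_pow, awayToRx_algebraMap, awayToRx_algebraMap] at e1
  have e2 := congrArg (fun z => awayToRx (s * u) x hsu (awayMul (A := A) s u z)) hma
  simp only [map_mul, map_pow, awayMul_algebraMap, awayToRx_algebraMap] at e2
  rw [e1, e2]


/-- `awayToRx` of a formal fraction `c / s` is the germ it represents. [folklore] -/
theorem awayToRx_frac (s : C) (x : Pt A B J) (hs : s ∉ Pt.under x) (c : C) (y : Rx x)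
    (hy : y * algebraMap C (Rx x) s = algebraMap C (Rx x) c) :
    awayToRx s x hs (algebraMap C (Localization.Away s) c * IsLocalization.Away.invSelf s) = y := by
  have hunit : IsUnit (algebraMap C (Rx x) s) :=
    IsLocalization.map_units (Rx x) (⟨s, hs⟩ : (Pt.under x).primeCompl)
  refine (hunit.mul_left_inj).1 ?_
  rw [hy, ← awayToRx_algebraMap s x hs s, ← map_mul, mul_assoc]
  change awayToRx s x hs (algebraMap C (Localization.Away s) c *
    (IsLocalization.Away.invSelf s * algebraMap C (Localization.Away s) s)) = _
  rw [mul_comm (IsLocalization.Away.invSelf s), IsLocalization.Away.mul_invSelf, mul_one,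
    awayToRx_algebraMap]

/-- `awayMul` of a formal fraction. [folklore] -/
theorem awayMul_frac (s u c : C) :
    awayMul (A := A) s u (algebraMap C (Localization.Away s) c * IsLocalization.Away.invSelf s) =
      algebraMap C (Localization.Away (s * u)) (c * u) * IsLocalization.Away.invSelf (s * u) := by
  have hunit : IsUnit (algebraMap C (Localization.Away (s * u)) (s * u)) :=
    IsLocalization.Away.algebraMap_isUnit (s * u)
  have e1 : awayMul (A := A) s u (IsLocalization.Away.invSelf s) *
      algebraMap C (Localization.Away (s * u)) s = 1 := by
    rw [← awayMul_algebraMap (A := A) s u s, ← map_mul, mul_comm (IsLocalization.Away.invSelf s),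
      IsLocalization.Away.mul_invSelf, map_one]
  have e2 : IsLocalization.Away.invSelf (s * u) *
      algebraMap C (Localization.Away (s * u)) (s * u) = 1 := by
    rw [mul_comm (IsLocalization.Away.invSelf (s * u)), IsLocalization.Away.mul_invSelf]
  refine (hunit.mul_left_inj).1 ?_
  rw [map_mul (awayMul (A := A) s u), awayMul_algebraMap]
  calc algebraMap C _ c * awayMul (A := A) s u (IsLocalization.Away.invSelf s) *
        algebraMap C (Localization.Away (s * u)) (s * u)
      = algebraMap C _ c * (awayMul (A := A) s u (IsLocalization.Away.invSelf s) *
          algebraMap C (Localization.Away (s * u)) s) * algebraMap C _ u := by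
        rw [map_mul (algebraMap C (Localization.Away (s * u))) s u]; ring
    _ = algebraMap C (Localization.Away (s * u)) (c * u) := by rw [e1, mul_one, map_mul]
    _ = algebraMap C (Localization.Away (s * u)) (c * u) *
          IsLocalization.Away.invSelf (s * u) * algebraMap C _ (s * u) := by
        rw [mul_assoc, e2, mul_one]

end Away

/-! ### Simultaneous representations of finitely many germs -/

/-- A common germ representation of a finite family. [folklore] -/
structure MultiRep (J : Ideal C) {n : ℕ} (f : Fin n → ∀ x : Pt A B J, Rx x) where
  /-- index set of the partition -/
  ι : Type
  /-- finiteness of the partition -/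
  fin : Fintype ι
  /-- the elements `t` of the pieces `D(t) ∩ V(F)` -/
  t : ι → C ⊗[A] B
  /-- the finite sets `F` of the pieces `D(t) ∩ V(F)` -/
  F : ι → Finset (C ⊗[A] B)
  /-- numerators -/
  c : Fin n → ι → C
  /-- denominators -/
  s : ι → C
  cover : ∀ x : Pt A B J, ∃ i, x ∈ piece (J := J) (t i) (F i)
  disj : ∀ (x : Pt A B J) (i j : ι), x ∈ piece (J := J) (t i) (F i) →
    x ∈ piece (J := J) (t j) (F j) → i = j
  denom : ∀ (x : Pt A B J) (i : ι), x ∈ piece (J := J) (t i) (F i) → s i ∉ Pt.under x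
  eq : ∀ (x : Pt A B J) (i : ι) (k : Fin n), x ∈ piece (J := J) (t i) (F i) →
    f k x * algebraMap C (Rx x) (s i) = algebraMap C (Rx x) (c k i)

/-- The empty family has a (trivial) common representation. [folklore] -/
def MultiRep.zero (f : Fin 0 → ∀ x : Pt A B J, Rx x) : MultiRep J f where
  ι := PUnit
  fin := inferInstance
  t := fun _ => 1
  F := fun _ => ∅
  c := fun k => k.elim0
  s := fun _ => 1
  cover := fun x => ⟨PUnit.unit, fun h => (inferInstance : x.1.asIdeal.IsPrime).ne_top
    ((Ideal.eq_top_iff_one _).2 h), fun g hg => absurd hg (Finset.notMem_empty g)⟩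
  disj := fun _ _ _ _ _ => rfl
  denom := fun x _ _ h => (inferInstance : (Pt.under x).IsPrime).ne_top
    ((Ideal.eq_top_iff_one _).2 h)
  eq := fun _ _ k => k.elim0

/-- Adjoining one more germ to a common representation. [folklore] -/
def MultiRep.succ [DecidableEq (C ⊗[A] B)] {n : ℕ} {f : Fin (n + 1) → ∀ x : Pt A B J, Rx x}
    (M : MultiRep J (fun k : Fin n => f k.castSucc)) (R : Rep J (f (Fin.last n))) :
    MultiRep J f := by
  letI := M.fin; letI := R.fin
  exact
  { ι := M.ι × R.ι
    fin := inferInstance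
    t := fun p => M.t p.1 * R.t p.2
    F := fun p => M.F p.1 ∪ R.F p.2
    c := fun k p => Fin.lastCases (R.c p.2 * M.s p.1) (fun k' => M.c k' p.1 * R.s p.2) k
    s := fun p => M.s p.1 * R.s p.2
    cover := fun x => by
      obtain ⟨i, hi⟩ := M.cover x
      obtain ⟨j, hj⟩ := R.cover x
      exact ⟨(i, j), mem_piece_mul_union.2 ⟨hi, hj⟩⟩
    disj := fun x p q hp hq => by
      obtain ⟨hp1, hp2⟩ := mem_piece_mul_union.1 hp
      obtain ⟨hq1, hq2⟩ := mem_piece_mul_union.1 hq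
      exact Prod.ext (M.disj x _ _ hp1 hq1) (R.disj x _ _ hp2 hq2)
    denom := fun x p hp h => by
      obtain ⟨hp1, hp2⟩ := mem_piece_mul_union.1 hp
      rcases (inferInstance : (Pt.under x).IsPrime).mem_or_mem h with h | h
      exacts [M.denom x _ hp1 h, R.denom x _ hp2 h]
    eq := fun x p k hp => by
      obtain ⟨hp1, hp2⟩ := mem_piece_mul_union.1 hp
      refine Fin.lastCases ?_ (fun k' => ?_) k
      · have e := R.eq x _ hp2
        simp only [Fin.lastCases_last, map_mul]
        linear_combination (algebraMap C (Rx x) (M.s p.1)) * e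
      · have e := M.eq x _ k' hp1
        simp only [Fin.lastCases_castSucc, map_mul]
        linear_combination (algebraMap C (Rx x) (R.s p.2)) * e }

/-- Finitely many germs have a common representation. [folklore] -/
theorem exists_multiRep [DecidableEq (C ⊗[A] B)] :
    ∀ {n : ℕ} (f : Fin n → ∀ x : Pt A B J, Rx x), (∀ k, IsGerm (f k)) → Nonempty (MultiRep J f)
  | 0, f, _ => ⟨MultiRep.zero f⟩
  | n + 1, f, hf => by
    obtain ⟨M⟩ := exists_multiRep (fun k : Fin n => f k.castSucc) (fun k => hf _)
    obtain ⟨R⟩ := hf (Fin.last n)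
    exact ⟨M.succ R⟩


/-! ### Refining a common representation so that given relations hold -/

/-- The formal fraction `c / s ∈ C[1/s]`. [folklore] -/
abbrev frac (s c : C) : Localization.Away s :=
  algebraMap C (Localization.Away s) c * IsLocalization.Away.invSelf s

/-- **Refinement**: given finitely many polynomial relations among germs `f₁, …, fₙ` holding
pointwise, a common representation can be refined (using quasi-compactness of the pieces) so
that the relations hold between the representing fractions in each `C[1/sᵢ]`.
[cite: BhattScholze2015, Thm 2.3.4] -/
theorem exists_refined [DecidableEq (C ⊗[A] B)] {n : ℕ} (f : Fin n → ∀ x : Pt A B J, Rx x)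
    (M : MultiRep J f) (G : Finset (MvPolynomial (Fin n) A))
    (hG : ∀ g ∈ G, ∀ x : Pt A B J, MvPolynomial.aeval (fun k => f k x) g = 0) :
    ∃ M' : MultiRep J f, ∀ g ∈ G, ∀ i : M'.ι,
      MvPolynomial.aeval (fun k => frac (M'.s i) (M'.c k i)) g = 0 := by
  classical
  letI := M.fin
  -- the relations as elements of `C[1/sᵢ]`, with cleared denominators
  let h : ∀ (g : MvPolynomial (Fin n) A) (i : M.ι), Localization.Away (M.s i) := fun g i =>
    MvPolynomial.aeval (fun k => frac (M.s i) (M.c k i)) g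
  have hsurj : ∀ (i : M.ι) (g : MvPolynomial (Fin n) A), ∃ (m : ℕ) (a : C),
      h g i * algebraMap C (Localization.Away (M.s i)) (M.s i) ^ m =
        algebraMap C (Localization.Away (M.s i)) a :=
    fun i g => IsLocalization.Away.surj (M.s i) (h g i)
  choose m a hma using hsurj
  -- the relations vanish in the local rings at points of the pieces
  have hvan : ∀ (i : M.ι) (x : Pt A B J) (hx : x ∈ piece (J := J) (M.t i) (M.F i)) (g : MvPolynomial (Fin n) A),
      g ∈ G → awayToRx (M.s i) x (M.denom x i hx) (h g i) = 0 := by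
    intro i x hx g hg
    change awayToRx (M.s i) x (M.denom x i hx) (MvPolynomial.aeval _ g) = 0
    rw [← AlgHom.comp_apply, MvPolynomial.comp_aeval]
    have : (fun k => awayToRx (M.s i) x (M.denom x i hx) (frac (M.s i) (M.c k i))) = fun k => f k x :=
      funext fun k => awayToRx_frac _ _ _ _ _ (M.eq x i k hx)
    rw [this]
    exact hG g hg x
  -- for each point of each piece, an element killing all numerators
  have hkill : ∀ (i : M.ι) (x : Pt A B J) (hx : x ∈ piece (J := J) (M.t i) (M.F i)),
      ∃ U : C, U ∉ Pt.under x ∧ ∀ g ∈ G, U * a i g = 0 := by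
    intro i x hx
    have hu : ∀ g : ↥G, ∃ u : C, u ∉ Pt.under x ∧ u * a i g = 0 := fun g =>
      exists_mul_numerator_eq_zero (M.s i) x (M.denom x i hx) (h g i) (m i g) (a i g)
        (hma i g) (hvan i x hx g g.2)
    choose u hu hua using hu
    refine ⟨∏ g : ↥G, u g, ?_, fun g hg => ?_⟩
    · intro hmem
      obtain ⟨g, -, hg⟩ := (Ideal.IsPrime.prod_mem_iff (p := Pt.under x)).1 hmem
      exact hu g hg
    · obtain ⟨w, hw⟩ := Finset.dvd_prod_of_mem u (Finset.mem_univ (⟨g, hg⟩ : ↥G))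
      rw [hw, mul_right_comm, hua ⟨g, hg⟩, zero_mul]
  choose U hU hUa using hkill
  -- quasi-compactness of the pieces: finitely many killers per piece
  have hfin : ∀ i : M.ι, ∃ T : Finset {x : Pt A B J // x ∈ piece (J := J) (M.t i) (M.F i)},
      ∀ x : Pt A B J, x ∈ piece (J := J) (M.t i) (M.F i) →
        ∃ p ∈ T, algebraMap C (C ⊗[A] B) (U i p.1 p.2) ∉ x.1.asIdeal := by
    intro i
    let S : Set (PrimeSpectrum (C ⊗[A] B)) :=
      (PrimeSpectrum.basicOpen (M.t i) : Set _) ∩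
        (PrimeSpectrum.zeroLocus (J.map (algebraMap C (C ⊗[A] B)) : Set (C ⊗[A] B)) ∩
          PrimeSpectrum.zeroLocus (M.F i : Set (C ⊗[A] B)))
    have hS : IsCompact S := (PrimeSpectrum.isCompact_basicOpen _).inter_right
      ((PrimeSpectrum.isClosed_zeroLocus _).inter (PrimeSpectrum.isClosed_zeroLocus _))
    let O : {x : Pt A B J // x ∈ piece (J := J) (M.t i) (M.F i)} → Set (PrimeSpectrum (C ⊗[A] B)) :=
      fun p => PrimeSpectrum.basicOpen (algebraMap C (C ⊗[A] B) (U i p.1 p.2))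
    have hcov : S ⊆ ⋃ p, O p := by
      intro y hy
      obtain ⟨hyt, hyJ, hyF⟩ := hy
      let x : Pt A B J := ⟨y, hyJ⟩
      have hx : x ∈ piece (J := J) (M.t i) (M.F i) :=
        ⟨(PrimeSpectrum.mem_basicOpen _ _).1 hyt, fun g hg => hyF hg⟩
      refine Set.mem_iUnion.2 ⟨⟨x, hx⟩, (PrimeSpectrum.mem_basicOpen _ _).2 (hU i x hx)⟩
    obtain ⟨T, hT⟩ := hS.elim_finite_subcover O (fun p => PrimeSpectrum.isOpen_basicOpen) hcov
    refine ⟨T, fun x hx => ?_⟩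
    have hxS : x.1 ∈ S := ⟨(PrimeSpectrum.mem_basicOpen _ _).2 hx.1, x.2, fun g hg => hx.2 g hg⟩
    obtain ⟨p, hp⟩ := Set.mem_iUnion.1 (hT hxS)
    obtain ⟨hpT, hpO⟩ := Set.mem_iUnion.1 hp
    exact ⟨p, hpT, (PrimeSpectrum.mem_basicOpen _ _).1 hpO⟩
  choose T hT using hfin
  -- enumerate the killers on each piece
  let N : M.ι → ℕ := fun i => (T i).card
  let pt : ∀ i, Fin (N i) → {x : Pt A B J // x ∈ piece (J := J) (M.t i) (M.F i)} :=
    fun i l => ((T i).equivFin.symm l).1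
  let uu : ∀ i, Fin (N i) → C := fun i l => U i (pt i l).1 (pt i l).2
  let uD : ∀ i, Fin (N i) → C ⊗[A] B := fun i l => algebraMap C (C ⊗[A] B) (uu i l)
  have hex : ∀ (x : Pt A B J) (i : M.ι), x ∈ piece (J := J) (M.t i) (M.F i) →
      ∃ l : Fin (N i), uD i l ∉ x.1.asIdeal := by
    intro x i hx
    obtain ⟨p, hpT, hp⟩ := hT i x hx
    refine ⟨(T i).equivFin ⟨p, hpT⟩, ?_⟩
    have : pt i ((T i).equivFin ⟨p, hpT⟩) = p := by simp [pt]
    change algebraMap C (C ⊗[A] B) (U i (pt i _).1 (pt i _).2) ∉ _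
    rw [this]
    exact hp
  -- the refined representation
  let F' : (Σ i, Fin (N i)) → Finset (C ⊗[A] B) := fun p =>
    M.F p.1 ∪ ((Finset.univ : Finset (Fin (N p.1))).filter (fun l => l < p.2)).image (uD p.1)
  have hmemF' : ∀ (p : Σ i, Fin (N i)) (g : C ⊗[A] B),
      g ∈ F' p ↔ g ∈ M.F p.1 ∨ ∃ l, l < p.2 ∧ uD p.1 l = g := by
    intro p g
    simp only [F', Finset.mem_union, Finset.mem_image, Finset.mem_filter, Finset.mem_univ,
      true_and]
  -- membership in a refined piece
  have hmem' : ∀ (x : Pt A B J) (p : Σ i, Fin (N i)),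
      x ∈ piece (J := J) (M.t p.1 * uD p.1 p.2) (F' p) ↔
        x ∈ piece (J := J) (M.t p.1) (M.F p.1) ∧ uD p.1 p.2 ∉ x.1.asIdeal ∧
          ∀ l, l < p.2 → uD p.1 l ∈ x.1.asIdeal := by
    intro x p
    constructor
    · rintro ⟨ht, hF⟩
      refine ⟨⟨fun hh => ht (x.1.asIdeal.mul_mem_right _ hh), fun g hg => hF g ((hmemF' p g).2 (Or.inl hg))⟩,
        fun hh => ht (x.1.asIdeal.mul_mem_left _ hh), fun l hl => hF _ ((hmemF' p _).2 (Or.inr ⟨l, hl, rfl⟩))⟩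
    · rintro ⟨⟨ht, hF⟩, hu, hl⟩
      refine ⟨fun hh => ?_, fun g hg => ?_⟩
      · rcases (inferInstance : x.1.asIdeal.IsPrime).mem_or_mem hh with hh | hh
        exacts [ht hh, hu hh]
      · rcases (hmemF' p g).1 hg with hg | ⟨l, hl', rfl⟩
        exacts [hF g hg, hl l hl']
  refine ⟨{ ι := Σ i, Fin (N i)
            fin := inferInstance
            t := fun p => M.t p.1 * uD p.1 p.2
            F := F'
            c := fun k p => M.c k p.1 * uu p.1 p.2
            s := fun p => M.s p.1 * uu p.1 p.2
            cover := fun x => ?_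
            disj := fun x p q hp hq => ?_
            denom := fun x p hp hh => ?_
            eq := fun x p k hp => ?_ }, fun g hg p => ?_⟩
  · obtain ⟨i, hi⟩ := M.cover x
    let K : Finset (Fin (N i)) := Finset.univ.filter fun l => uD i l ∉ x.1.asIdeal
    have hK : K.Nonempty := by
      obtain ⟨l, hl⟩ := hex x i hi
      exact ⟨l, Finset.mem_filter.2 ⟨Finset.mem_univ _, hl⟩⟩
    refine ⟨⟨i, K.min' hK⟩, (hmem' x ⟨i, K.min' hK⟩).2 ⟨hi, (Finset.mem_filter.1 (K.min'_mem hK)).2,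
      fun l hl => ?_⟩⟩
    by_contra hlx
    have : K.min' hK ≤ l := K.min'_le l (Finset.mem_filter.2 ⟨Finset.mem_univ _, hlx⟩)
    exact absurd hl (not_lt.2 this)
  · obtain ⟨hp1, hp2, hp3⟩ := (hmem' x p).1 hp
    obtain ⟨hq1, hq2, hq3⟩ := (hmem' x q).1 hq
    obtain ⟨i, l⟩ := p
    obtain ⟨i', l'⟩ := q
    obtain rfl : i = i' := M.disj x _ _ hp1 hq1
    rcases lt_trichotomy l l' with hh | hh | hh
    · exact absurd (hq3 l hh) hp2
    · rw [hh]
    · exact absurd (hp3 l' hh) hq2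
  · obtain ⟨hp1, hp2, -⟩ := (hmem' x p).1 hp
    rcases (inferInstance : (Pt.under x).IsPrime).mem_or_mem hh with hh | hh
    · exact M.denom x _ hp1 hh
    · exact hp2 hh
  · obtain ⟨hp1, -, -⟩ := (hmem' x p).1 hp
    have e := M.eq x _ k hp1
    simp only [map_mul]
    linear_combination (algebraMap C (Rx x) (uu p.1 p.2)) * e
  · -- the relation `g` holds in `C[1/(sᵢ u)]`
    change MvPolynomial.aeval (fun k => frac (M.s p.1 * uu p.1 p.2) (M.c k p.1 * uu p.1 p.2)) g = 0
    have : (fun k => frac (M.s p.1 * uu p.1 p.2) (M.c k p.1 * uu p.1 p.2)) =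
        fun k => awayMul (A := A) (M.s p.1) (uu p.1 p.2) (frac (M.s p.1) (M.c k p.1)) :=
      funext fun k => (awayMul_frac _ _ _).symm
    rw [this, ← MvPolynomial.comp_aeval, AlgHom.comp_apply]
    exact awayMul_eq_zero (M.s p.1) (uu p.1 p.2) (h g p.1) (m p.1 g) (a p.1 g) (hma p.1 g)
      (hUa p.1 (pt p.1 p.2).1 (pt p.1 p.2).2 g hg)

variable (A B J) in
/-- **The germ ring** `C♮`, as a `C`-subalgebra of `∏_{x ∈ X♮} C_{x ∩ C}`.
[cite: BhattScholze2015, Thm 2.3.4] -/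
def germAlg : Subalgebra C (∀ x : Pt A B J, Rx x) where
  carrier := {f | IsGerm f}
  mul_mem' := fun hf hg => hf.mul hg
  add_mem' := fun hf hg => hf.add hg
  algebraMap_mem' := fun c₀ => isGerm_algebraMap c₀

/-- Membership in the germ ring. [folklore] -/
theorem mem_germAlg {f : ∀ x : Pt A B J, Rx x} : f ∈ germAlg A B J ↔ IsGerm f := Iff.rfl

variable (A B J) in
/-- The germ ring as an `A`-algebra. [cite: BhattScholze2015, Thm 2.3.4] -/
abbrev germAlgA : Subalgebra A (∀ x : Pt A B J, Rx x) := (germAlg A B J).restrictScalars A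



/-! ### The germ ring is ind-étale -/

/-- Evaluation of the germ ring at a point. [folklore] -/
def evalGerm (x : Pt A B J) : germAlgA A B J →ₐ[A] Rx x :=
  (Pi.evalAlgHom A (fun y : Pt A B J => Rx y) x).comp (germAlgA A B J).val

/-- `evalGerm` is evaluation. [folklore] -/
theorem evalGerm_apply (x : Pt A B J) (f : germAlgA A B J) : evalGerm x f = (f : ∀ y, Rx y) x := rfl

/-- **The germ ring is ind-étale** when `C` is: a finitely presented `A`-algebra `P` mapping to
`C♮` factors through a finite product `∏ C[1/sᵢ]` (which is ind-étale over `A`), after refining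
a common representation of the images of the generators so that the relations of `P` hold in
each `C[1/sᵢ]`. [cite: BhattScholze2015, Thm 2.3.4] -/
theorem factorsEtale_germAlgA (hC : FactorsEtale A C) : FactorsEtale A (germAlgA A B J) := by
  classical
  intro P _ _ _ φ
  obtain ⟨n, π, hπ, ⟨G, hG⟩⟩ := Algebra.FinitePresentation.out (R := A) (A := P)
  -- the germs of the generators and a common representation
  let f : Fin n → ∀ x : Pt A B J, Rx x := fun k => ((φ (π (MvPolynomial.X k)) : germAlgA A B J) : ∀ x, Rx x)
  have hf : ∀ k, IsGerm (f k) := fun k => (φ (π (MvPolynomial.X k))).2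
  obtain ⟨M⟩ := exists_multiRep f hf
  -- the relations hold pointwise
  have hGx : ∀ g ∈ G, ∀ x : Pt A B J, MvPolynomial.aeval (fun k => f k x) g = 0 := by
    intro g hg x
    have hker : π g = 0 := by
      have : g ∈ RingHom.ker π.toRingHom := hG ▸ Ideal.subset_span hg
      exact this
    have hcomp : ((evalGerm x).comp (φ.comp π)) = MvPolynomial.aeval (fun k => f k x) :=
      MvPolynomial.algHom_ext fun k => by simp [evalGerm_apply, f]
    rw [← hcomp, AlgHom.comp_apply, AlgHom.comp_apply, hker, map_zero, map_zero]
  obtain ⟨M', hM'⟩ := exists_refined f M G hGx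
  letI := M'.fin
  -- the ind-étale ring `E = ∏ᵢ C[1/sᵢ]`
  let E : Type u := ∀ i : ULift.{u} M'.ι, Localization.Away (M'.s i.down)
  have hE : FactorsEtale A E :=
    FactorsEtale.pi _ fun i => hC.localization (Submonoid.powers (M'.s i.down)) _
  let qq : Fin n → E := fun k i => frac (M'.s i.down) (M'.c k i.down)
  have hχ : ∀ g ∈ G, MvPolynomial.aeval qq g = 0 := by
    intro g hg
    funext i
    have : (Pi.evalAlgHom A (fun i : ULift.{u} M'.ι => Localization.Away (M'.s i.down)) i)
        (MvPolynomial.aeval qq g) =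
        MvPolynomial.aeval (fun k => frac (M'.s i.down) (M'.c k i.down)) g := by
      rw [← AlgHom.comp_apply, MvPolynomial.comp_aeval]; rfl
    exact this.trans (hM' g hg i.down)
  have hkerχ : RingHom.ker π.toRingHom ≤ RingHom.ker (MvPolynomial.aeval qq).toRingHom := by
    rw [← hG, Ideal.span_le]
    intro g hg
    exact hχ g hg
  let χ' : P →ₐ[A] E := AlgHom.liftOfSurjective π hπ (MvPolynomial.aeval qq) hkerχ
  have hχ' : χ'.comp π = MvPolynomial.aeval qq :=
    AlgHom.liftOfSurjective_comp π hπ (MvPolynomial.aeval qq) hkerχ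
  -- the map `E → C♮`
  have hidx : ∀ x : Pt A B J, ∃ i, x ∈ piece (J := J) (M'.t i) (M'.F i) := M'.cover
  choose idx hidx using hidx
  let θ : ∀ x : Pt A B J, Localization.Away (M'.s (idx x)) →ₐ[A] Rx x :=
    fun x => awayToRx (M'.s (idx x)) x (M'.denom x _ (hidx x))
  let ψ : E →ₐ[A] (∀ x : Pt A B J, Rx x) :=
    { RingHom.pi fun x => (θ x).toRingHom.comp
        (Pi.evalRingHom (fun i : ULift.{u} M'.ι => Localization.Away (M'.s i.down)) ⟨idx x⟩) with
      commutes' := fun a => funext fun x => by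
        change θ x (algebraMap A E a ⟨idx x⟩) = algebraMap A (Rx x) a
        rw [Pi.algebraMap_apply]
        exact (θ x).commutes a }
  have hψ : ∀ (e : E) (x : Pt A B J), ψ e x = θ x (e ⟨idx x⟩) := fun e x => rfl
  -- `ψ` lands in the germ ring
  have hψmem : ∀ e : E, ψ e ∈ germAlgA A B J := by
    intro e
    have hs : ∀ i : M'.ι, ∃ (m : ℕ) (a : C), e ⟨i⟩ * algebraMap C _ (M'.s i) ^ m = algebraMap C _ a :=
      fun i => IsLocalization.Away.surj (M'.s i) (e ⟨i⟩)
    choose m a hma using hs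
    refine ⟨{ ι := M'.ι
              fin := inferInstance
              t := M'.t
              F := M'.F
              c := a
              s := fun i => M'.s i ^ m i
              cover := M'.cover
              disj := M'.disj
              denom := fun x i hx hh => M'.denom x i hx
                ((inferInstance : (Pt.under x).IsPrime).mem_of_pow_mem _ hh)
              eq := fun x i hx => ?_ }⟩
    have hi : idx x = i := M'.disj x _ _ (hidx x) hx
    subst hi
    rw [hψ, map_pow, ← awayToRx_algebraMap (M'.s (idx x)) x (M'.denom x _ (hidx x)) (M'.s (idx x)),
      ← map_pow, ← map_mul, hma, awayToRx_algebraMap]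
  let ψ' : E →ₐ[A] germAlgA A B J := ψ.codRestrict (germAlgA A B J) hψmem
  -- factor `χ'` through an étale algebra
  obtain ⟨Bet, _, _, _, α, β, hαβ⟩ := hE P χ'
  refine ⟨Bet, inferInstance, inferInstance, inferInstance, α, ψ'.comp β, ?_⟩
  rw [AlgHom.comp_assoc, hαβ]
  -- `ψ' ∘ χ' = φ`: check on generators
  have key : (ψ'.comp χ').comp π = φ.comp π := by
    rw [AlgHom.comp_assoc, hχ']
    refine MvPolynomial.algHom_ext fun k => ?_
    apply Subtype.ext
    funext x
    change ψ (MvPolynomial.aeval qq (MvPolynomial.X k)) x = f k x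
    rw [MvPolynomial.aeval_X, hψ]
    exact awayToRx_frac _ _ _ _ _ (M'.eq x _ k (hidx x))
  refine AlgHom.ext fun y => ?_
  obtain ⟨g, rfl⟩ := hπ y
  exact DFunLike.congr_fun key g

/-! ### The local isomorphisms and the germ maps -/

variable [Algebra.WeaklyEtale A B]
  (hret : ∀ (Y : Type u) [CommRing Y] [Algebra C Y] [Algebra.Etale C Y]
    [Module.FaithfullyFlat C Y], Nonempty (Y →ₐ[C] C))
  (hJ : ∀ Q : Ideal C, Q.IsPrime → J ≤ Q → Q.IsMaximal)

include hret hJ in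
/-- `C_{x ∩ C} → (C ⊗ B)_x` is bijective for `x ∈ X♮`. [cite: BhattScholze2015, Thm 2.3.4] -/
theorem locx_bijective (x : Pt A B J) : Function.Bijective (locx x) :=
  bijective_localRingHom_of_retraction hret x.1.asIdeal (hJ _ inferInstance (Pt.le_under x))

/-- The inverse isomorphism `(C ⊗ B)_x ≃ C_{x ∩ C}`. [cite: BhattScholze2015, Thm 2.3.4] -/
def εx (x : Pt A B J) : Sx x ≃+* Rx x :=
  (RingEquiv.ofBijective (locx x) (locx_bijective hret hJ x)).symm

/-- `εx ∘ locx = id`. [folklore] -/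
theorem εx_locx (x : Pt A B J) (y : Rx x) : εx hret hJ x (locx x y) = y :=
  (RingEquiv.ofBijective (locx x) (locx_bijective hret hJ x)).symm_apply_apply y

/-- `locx ∘ εx = id`. [folklore] -/
theorem locx_εx (x : Pt A B J) (z : Sx x) : locx x (εx hret hJ x z) = z :=
  (RingEquiv.ofBijective (locx x) (locx_bijective hret hJ x)).apply_symm_apply z

/-- `εx` on elements of `C`. [folklore] -/
theorem εx_algebraMap (x : Pt A B J) (c : C) :
    εx hret hJ x (algebraMap (C ⊗[A] B) (Sx x) (algebraMap C (C ⊗[A] B) c)) =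
      algebraMap C (Rx x) c := by
  rw [← locx_algebraMap, εx_locx]

/-- The germ map `ρ_x : B → C_{x ∩ C}`, `b ↦ ε_x (1 ⊗ b)`. [cite: BhattScholze2015, Thm 2.3.4] -/
def ρ (x : Pt A B J) : B →+* Rx x :=
  (εx hret hJ x).toRingHom.comp ((algebraMap (C ⊗[A] B) (Sx x)).comp
    (Algebra.TensorProduct.includeRight (R := A) (A := C) (B := B)).toRingHom)

/-- Unfolding `ρ`. [folklore] -/
theorem ρ_apply (x : Pt A B J) (b : B) :
    ρ hret hJ x b = εx hret hJ x (algebraMap (C ⊗[A] B) (Sx x) ((1 : C) ⊗ₜ[A] b)) := rfl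

/-- `ρ_x` restricted to `A` is the structure map of `C_{x ∩ C}`. [folklore] -/
theorem ρ_algebraMap (x : Pt A B J) (a : A) :
    ρ hret hJ x (algebraMap A B a) = algebraMap C (Rx x) (algebraMap A C a) := by
  rw [ρ_apply, ← εx_algebraMap hret hJ x (algebraMap A C a)]
  congr 2
  rw [← IsScalarTower.algebraMap_apply, Algebra.TensorProduct.algebraMap_apply,
    Algebra.algebraMap_eq_smul_one, Algebra.algebraMap_eq_smul_one, TensorProduct.smul_tmul]

/-- **Germs are fractions where fractions kill numerators**: if `t (s ⊗ b - c ⊗ 1) = 0` in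
`C ⊗ B` with `t ∉ x`, then `ρ_x(b) · s = c` in `C_{x ∩ C}`. [folklore] -/
theorem ρ_mul_eq (x : Pt A B J) (b : B) (c s : C) (t : C ⊗[A] B) (ht : t ∉ x.1.asIdeal)
    (h : t * (algebraMap C (C ⊗[A] B) s * ((1 : C) ⊗ₜ[A] b) - algebraMap C (C ⊗[A] B) c) = 0) :
    ρ hret hJ x b * algebraMap C (Rx x) s = algebraMap C (Rx x) c := by
  have hu : IsUnit (algebraMap (C ⊗[A] B) (Sx x) t) :=
    IsLocalization.map_units (Sx x) (⟨t, ht⟩ : x.1.asIdeal.primeCompl)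
  have h1 : algebraMap (C ⊗[A] B) (Sx x) (algebraMap C (C ⊗[A] B) s * ((1 : C) ⊗ₜ[A] b)) =
      algebraMap (C ⊗[A] B) (Sx x) (algebraMap C (C ⊗[A] B) c) := by
    have := congrArg (algebraMap (C ⊗[A] B) (Sx x)) h
    rw [map_mul, map_zero, map_sub] at this
    exact sub_eq_zero.1 ((hu.mul_right_eq_zero).1 this)
  rw [ρ_apply, ← εx_algebraMap hret hJ x s, ← εx_algebraMap hret hJ x c, ← map_mul, ← map_mul,
    mul_comm, h1]

include hret hJ in
/-- **Every germ is a fraction near `x`**: for `b ∈ B` there are `c, s ∈ C`, `s ∉ x ∩ C`, and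
`t ∉ x` with `t (s ⊗ b - c ⊗ 1) = 0`. [folklore] -/
theorem exists_fraction (x : Pt A B J) (b : B) :
    ∃ (c s : C) (t : C ⊗[A] B), s ∉ Pt.under x ∧ t ∉ x.1.asIdeal ∧
      t * (algebraMap C (C ⊗[A] B) s * ((1 : C) ⊗ₜ[A] b) - algebraMap C (C ⊗[A] B) c) = 0 := by
  obtain ⟨⟨c, s⟩, hcs⟩ := IsLocalization.mk'_surjective (Pt.under x).primeCompl (ρ hret hJ x b)
  -- in `(C ⊗ B)_x`: `s ⊗ b = c ⊗ 1`
  have h1 : algebraMap (C ⊗[A] B) (Sx x) (algebraMap C (C ⊗[A] B) s * ((1 : C) ⊗ₜ[A] b)) =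
      algebraMap (C ⊗[A] B) (Sx x) (algebraMap C (C ⊗[A] B) c) := by
    have h2 : ρ hret hJ x b * algebraMap C (Rx x) s = algebraMap C (Rx x) c := by
      rw [← hcs, IsLocalization.mk'_spec]
    have h3 := congrArg (locx x) h2
    rw [map_mul, ρ_apply, locx_εx, locx_algebraMap, locx_algebraMap, ← map_mul, mul_comm] at h3
    exact h3
  obtain ⟨t, ht⟩ := (IsLocalization.eq_iff_exists x.1.asIdeal.primeCompl (Sx x)).1 h1
  refine ⟨c, s, t, s.2, t.2, ?_⟩
  rw [mul_sub, sub_eq_zero]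
  exact ht

/-! ### The map `B → C♮` -/

/-- `b ↦ (ρ_x b)_x`. [cite: BhattScholze2015, Thm 2.3.4] -/
def germOfB : B →ₐ[A] (∀ x : Pt A B J, Rx x) :=
  { RingHom.pi fun x => ρ hret hJ x with
    commutes' := fun a => funext fun x => by
      change ρ hret hJ x (algebraMap A B a) = algebraMap A (Rx x) a
      rw [ρ_algebraMap, ← IsScalarTower.algebraMap_apply] }

/-- Unfolding `germOfB`. [folklore] -/
theorem germOfB_apply (b : B) (x : Pt A B J) : germOfB hret hJ b x = ρ hret hJ x b := rfl

/-- **`B` maps into the germ ring**: the germ of `b` is a fraction on a neighbourhood of each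
point; a finite subcover of the (quasi-compact) `X♮` is turned into a partition by basic pieces.
[cite: BhattScholze2015, Thm 2.3.4] -/
theorem isGerm_germOfB (b : B) : IsGerm (germOfB (A := A) hret hJ b) := by
  classical
  choose c s t hs ht heq using fun x : Pt A B J => exists_fraction hret hJ x b
  -- the compact set `X♮ ⊆ Spec (C ⊗ B)` and its cover
  set X : Set (PrimeSpectrum (C ⊗[A] B)) :=
    PrimeSpectrum.zeroLocus (J.map (algebraMap C (C ⊗[A] B)) : Set (C ⊗[A] B))
  have hXc : IsCompact X := (PrimeSpectrum.isClosed_zeroLocus _).isCompact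
  let U : Pt A B J → Set (PrimeSpectrum (C ⊗[A] B)) := fun x =>
    PrimeSpectrum.basicOpen (t x * algebraMap C (C ⊗[A] B) (s x))
  have hcov : X ⊆ ⋃ x, U x := by
    intro y hy
    let x : Pt A B J := ⟨y, hy⟩
    refine Set.mem_iUnion.2 ⟨x, ?_⟩
    change y ∈ PrimeSpectrum.basicOpen _
    rw [PrimeSpectrum.mem_basicOpen]
    intro hmem
    rcases (inferInstance : y.asIdeal.IsPrime).mem_or_mem hmem with h | h
    · exact ht x h
    · exact hs x h
  obtain ⟨T, hT⟩ := hXc.elim_finite_subcover U (fun x => PrimeSpectrum.isOpen_basicOpen) hcov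
  -- enumerate the finite subcover
  set n := T.card
  let e : Fin n ≃ {x // x ∈ T} := T.equivFin.symm
  let pt : Fin n → Pt A B J := fun k => (e k).1
  let t' : Fin n → C ⊗[A] B := fun k => t (pt k) * algebraMap C (C ⊗[A] B) (s (pt k))
  let F' : Fin n → Finset (C ⊗[A] B) := fun k =>
    ((Finset.univ : Finset (Fin n)).filter (fun j => j < k)).image t'
  have hmemF' : ∀ k g, g ∈ F' k ↔ ∃ j, j < k ∧ t' j = g := by
    intro k g
    simp only [F', Finset.mem_image, Finset.mem_filter, Finset.mem_univ, true_and]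
  -- every point lies in some `D(t' k)`
  have hex : ∀ x : Pt A B J, ∃ k : Fin n, t' k ∉ x.1.asIdeal := by
    intro x
    have hx : x.1 ∈ X := x.2
    obtain ⟨p, hp⟩ := Set.mem_iUnion.1 (hT hx)
    obtain ⟨hpT, hpU⟩ := Set.mem_iUnion.1 hp
    refine ⟨e.symm ⟨p, hpT⟩, ?_⟩
    have : pt (e.symm ⟨p, hpT⟩) = p := by simp [pt]
    change t (pt _) * _ ∉ _
    rw [this]
    exact (PrimeSpectrum.mem_basicOpen _ _).1 hpU
  refine ⟨{ ι := Fin n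
            fin := inferInstance
            t := t'
            F := F'
            c := fun k => c (pt k)
            s := fun k => s (pt k)
            cover := fun x => ?_
            disj := fun x k l hk hl => ?_
            denom := fun x k hk h => ?_
            eq := fun x k hk => ?_ }⟩
  · -- the minimal `k` with `t' k ∉ x`
    let K : Finset (Fin n) := Finset.univ.filter fun k => t' k ∉ x.1.asIdeal
    have hK : K.Nonempty := by
      obtain ⟨k, hk⟩ := hex x
      exact ⟨k, Finset.mem_filter.2 ⟨Finset.mem_univ _, hk⟩⟩
    refine ⟨K.min' hK, (Finset.mem_filter.1 (K.min'_mem hK)).2, fun g hg => ?_⟩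
    obtain ⟨j, hj, rfl⟩ := (hmemF' _ g).1 hg
    by_contra hjx
    have : K.min' hK ≤ j := K.min'_le j (Finset.mem_filter.2 ⟨Finset.mem_univ _, hjx⟩)
    exact absurd hj (not_lt.2 this)
  · rcases lt_trichotomy k l with h | h | h
    · exact absurd (hl.2 (t' k) ((hmemF' l _).2 ⟨k, h, rfl⟩)) hk.1
    · exact h
    · exact absurd (hk.2 (t' l) ((hmemF' k _).2 ⟨l, h, rfl⟩)) hl.1
  · refine hk.1 (x.1.asIdeal.mul_mem_left _ ?_)
    exact h
  · have h1 : t (pt k) ∉ x.1.asIdeal := fun h => hk.1 (x.1.asIdeal.mul_mem_right _ h)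
    exact ρ_mul_eq hret hJ x b (c (pt k)) (s (pt k)) (t (pt k)) h1 (heq (pt k))

/-- The germ of `b` lies in the germ ring. [cite: BhattScholze2015, Thm 2.3.4] -/
theorem germOfB_mem (b : B) : germOfB hret hJ b ∈ germAlgA A B J := isGerm_germOfB hret hJ b

/-- **The comparison map `B → C♮`.** [cite: BhattScholze2015, Thm 2.3.4] -/
def ΦB : B →ₐ[A] germAlgA A B J := (germOfB hret hJ).codRestrict (germAlgA A B J) (germOfB_mem hret hJ)

/-- Unfolding `ΦB`. [folklore] -/
theorem ΦB_apply (b : B) (x : Pt A B J) : ((ΦB hret hJ b : germAlgA A B J) : ∀ x, Rx x) x = ρ hret hJ x b :=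
  rfl


/-! ### Flatness and faithful flatness of `B → C♮` -/

/-- Germs of elements of a prime `𝔫 ⊆ B` below the point `x` are non-units. [folklore] -/
theorem ρ_mem_maximalIdeal (x : Pt A B J) (b : B) (hb : (1 : C) ⊗ₜ[A] b ∈ x.1.asIdeal) :
    ρ hret hJ x b ∈ maximalIdeal (Rx x) := by
  rw [IsLocalRing.mem_maximalIdeal, mem_nonunits_iff]
  intro hu
  have h1 : IsUnit (locx x (ρ hret hJ x b)) := hu.map (locx x)
  rw [ρ_apply, locx_εx] at h1
  have h2 : algebraMap (C ⊗[A] B) (Sx x) ((1 : C) ⊗ₜ[A] b) ∈ maximalIdeal (Sx x) :=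
    (IsLocalization.AtPrime.to_map_mem_maximal_iff (Sx x) x.1.asIdeal _).2 hb
  exact (IsLocalRing.mem_maximalIdeal _).1 h2 h1

include hret hJ in
/-- **The globalization (Bhatt–Scholze 2.3.4, global step).**  With notation as in this file,
if `A → C` is ind-étale then the germ ring `C♮` is an ind-étale `A`-algebra and `B → C♮` is
flat (Stacks 092C: `C♮` is flat over `A` and `A → B` is weakly étale); if moreover every
maximal ideal of `B` lies below a point of `X♮`, then `B → C♮` is faithfully flat.
[cite: BhattScholze2015, Theorem 2.3.4; StacksProject, Tag 097Z] -/
theorem exists_factorsEtale_faithfullyFlat (hC : FactorsEtale A C)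
    (hsurj : ∀ 𝔫 : Ideal B, 𝔫.IsMaximal → ∃ x : Pt A B J, ∀ b ∈ 𝔫, (1 : C) ⊗ₜ[A] b ∈ x.1.asIdeal) :
    ∃ (G : Type u) (_ : CommRing G) (_ : Algebra A G) (Φ : B →ₐ[A] G),
      FactorsEtale A G ∧ Φ.toRingHom.FaithfullyFlat := by
  have hFE : FactorsEtale A (germAlgA A B J) := factorsEtale_germAlgA hC
  refine ⟨germAlgA A B J, inferInstance, inferInstance, ΦB hret hJ, hFE, ?_⟩
  letI : Algebra B (germAlgA A B J) := (ΦB hret hJ).toRingHom.toAlgebra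
  haveI : IsScalarTower A B (germAlgA A B J) := IsScalarTower.of_algebraMap_eq fun a => by
    change algebraMap A (germAlgA A B J) a = ΦB hret hJ (algebraMap A B a)
    rw [AlgHom.commutes]
  haveI : Module.Flat A (germAlgA A B J) := hFE.flat
  haveI : Module.Flat B (germAlgA A B J) := flat_algebraMap_of_weaklyEtale_left A B (germAlgA A B J)
  change (algebraMap B (germAlgA A B J)).FaithfullyFlat
  rw [RingHom.faithfullyFlat_algebraMap_iff]
  refine ⟨fun 𝔫 h𝔫 htop => ?_⟩
  obtain ⟨x, hx⟩ := hsurj 𝔫 h𝔫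
  -- `𝔫 C♮` maps into the maximal ideal of `C_{x ∩ C}` under evaluation at `x`
  have hle : 𝔫.map (algebraMap B (germAlgA A B J)) ≤
      (maximalIdeal (Rx x)).comap (evalGerm x).toRingHom := by
    rw [Ideal.map_le_iff_le_comap]
    intro b hb
    rw [Ideal.mem_comap, Ideal.mem_comap]
    exact ρ_mem_maximalIdeal hret hJ x b (hx b hb)
  have h1 : (1 : germAlgA A B J) ∈ 𝔫.map (algebraMap B (germAlgA A B J)) := by
    have : (1 : germAlgA A B J) ∈ (𝔫 • (⊤ : Submodule B (germAlgA A B J))) := by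
      rw [htop]; exact Submodule.mem_top
    rw [Ideal.smul_top_eq_map] at this
    exact this
  have h2 := hle h1
  rw [Ideal.mem_comap, map_one] at h2
  exact (maximalIdeal.isMaximal (Rx x)).ne_top ((Ideal.eq_top_iff_one _).2 h2)

end GermRing

end

end Literature.RingTheory.Etale
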